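import Summits.Ventures.LatticeQCDFlow.Scaling.WarmStartAugmentation
import Summits.Ventures.LatticeQCDFlow.Scaling.RegenerationTagDecay

/-!
HONEST FRAMING: exact (Metropolis-corrected) sampling algorithms for lattice gauge theory; figures
of merit are autocorrelation/cost numbers at stated couplings and volumes; no continuum-physics
claim.

# WarmStartCeiling — RE-EQUILIBRATION AFTER A PERTURBATION: IF THE MAP-ASSISTED HOT-REFRESHED HUB IS STARTED WITH THE
# REPLICAS OF A SET `D₀` PINNED AT ARBITRARY VALUES AND ALL OTHER REPLICAS EXACTLY DISTRIBUTED, THEN UNDER ONE-SIDED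
# DOMINATION `p` AND `4t ≤ p(1−t)w_0` ITS LAW IS WITHIN `((2·#(D₀∖{0}) + p·𝟙{0∈D₀})/p)·(1 − tcp/(2m))ⁿ` OF `π̃` AT TIME `n`
# — `(2m/(tcp))·log((2j+p)/(pε))` STEPS FOR `j` PERTURBED COLD REPLICAS: `log j`, NOT `log K` (lean-2 GEN-26, ours)

Venture-side (OURS).  Cell `lqcd-flow` (pub-lqcd), unit `pub-lqcd-lean-2-g26`, 2026-08-27.  Chapter M, file 24 — the warm
start.  Setting of `Scaling/DominatedStarMixingCeiling`; the initial configuration law is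
`λ₀(z) = Π_{j∈D₀} 𝟙{z_j = x_j} · Π_{j∉D₀} μ_j(z_j)` (the replicas in `D₀` pinned at `x`, the others independent and
exact), realised as the product law `tensorFun g` of the one-coordinate laws `g_j = δ_{x_j}` (`j ∈ D₀`), `g_j = μ_j`
(`j ∉ D₀`).  Its augmentation `Λ₀(z, D) = 𝟙{D = D₀}·λ₀(z)` is fresh, so `Scaling/WarmStartAugmentation` applies with tag
marginal `δ_{D₀}`.

## What is proved

* §1 `pinnedLaw_mass_one`, `pinnedLaw_nonneg`, **`pinnedAug_fresh`** (the augmented warm start is fresh), its marginals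
  (`pinnedAug_fst`, `pinnedAug_snd`).
* §2 **`warmStart_tvDist_le_stale`** — `‖λ₀Pⁿ − π̃‖_TV ≤ Σ_{D≠∅}(δ_{D₀}Qⁿ)(D)` (both one-sided constants);
  **`warmStart_tvDist_le`** — one-sided domination `p`, `4t ≤ p(1−t)w_0`:
  **`‖λ₀Pⁿ − π̃‖_TV ≤ ((2·#(D₀∖{0}) + p·𝟙{0 ∈ D₀})/p)·(1 − tcp/(2m))ⁿ`**; **`warmStart_tvDist_le_of_ge_log`** — `≤ ε` once
  `n ≥ (2m/(tcp))·log((2·#(D₀∖{0}) + p·𝟙{0∈D₀})/(pε))`.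

Reading (no numerics implied): a tempering run at equilibrium in which `j` cold replicas are overwritten (a restart
of part of the ladder, a corrupted checkpoint, an injected configuration) is back within `ε` of `π̃` after
`(2m/(tcp))·log((2j+p)/(pε))` steps — the cold start of chapter M is the case `D₀ = univ`, and the `log K` of the
coupon collector is replaced by `log j`.  NOT CLAIMED: starts that are not exact off `D₀` (correlated or approximate
replicas need the full cold-start bound or a domination argument of their own); the regime restriction for imperfect
maps; anything measured.  Literature grade (cell rule): OWN RESULT; nothing cited as a fact; no new bib keys.
-/

noncomputable section

open Finset Function
open Literature.Probability.MarkovChains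

namespace Summit.Ventures.LatticeQCDFlow.Scaling

variable {S : Type*} [Fintype S] [DecidableEq S] {K m : ℕ} {μ : Fin (K + 1) → S → ℝ} {M : Fin (K + 1) → S → S → ℝ}
  {w : Fin (K + 1) → ℝ} {t p q : ℝ}

section WarmStart
variable (κ : Fin m → Fin K) (φ : Fin m → Equiv.Perm S)

/-! ## §1 The pinned product law and its fresh augmentation -/

/-- The one-coordinate laws of the warm start have unit mass: `Σ_u g_j(u) = 1`. [ours] -/
theorem pinnedLaw_mass_one (hμ1 : ∀ k, ∑ u, μ k u = 1) (D₀ : Finset (Fin (K + 1))) (x : Fin (K + 1) → S)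
    {g : Fin (K + 1) → S → ℝ} (hg' : ∀ j u, g j u = if j ∈ D₀ then (if u = x j then (1 : ℝ) else 0) else μ j u)
    (j : Fin (K + 1)) : ∑ u, g j u = 1 := by
  simp_rw [hg' j]
  split_ifs
  · rw [Finset.sum_ite_eq' univ (x j), if_pos (mem_univ _)]
  · exact hμ1 j

omit [Fintype S] in
/-- The warm start is non-negative. [ours] -/
theorem pinnedLaw_nonneg (hμ : ∀ k x, 0 < μ k x) (D₀ : Finset (Fin (K + 1))) (x : Fin (K + 1) → S)
    {g : Fin (K + 1) → S → ℝ} (hg' : ∀ j u, g j u = if j ∈ D₀ then (if u = x j then (1 : ℝ) else 0) else μ j u)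
    (z : Fin (K + 1) → S) : 0 ≤ tensorFun g z := by
  unfold tensorFun
  refine Finset.prod_nonneg fun j _ => ?_
  rw [hg' j]
  split_ifs
  · norm_num
  · norm_num
  · exact (hμ j _).le

omit [Fintype S] in
/-- **THE AUGMENTED WARM START `Λ₀(z, D) = 𝟙{D = D₀}·λ₀(z)` IS FRESH:** every coordinate outside `D₀` is exactly
`μ_j`-distributed given the rest. [ours] -/
theorem pinnedAug_fresh (D₀ : Finset (Fin (K + 1))) (x : Fin (K + 1) → S)
    {g : Fin (K + 1) → S → ℝ} (hg' : ∀ j u, g j u = if j ∈ D₀ then (if u = x j then (1 : ℝ) else 0) else μ j u)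
    {Λ₀ : (Fin (K + 1) → S) × Finset (Fin (K + 1)) → ℝ}
    (hΛ : ∀ a, Λ₀ a = (if a.2 = D₀ then (1 : ℝ) else 0) * tensorFun g a.1) :
    ∀ (z : Fin (K + 1) → S) (D : Finset (Fin (K + 1))) (j : Fin (K + 1)) (v : S), j ∉ D →
      Λ₀ (update z j v, D) * μ j (z j) = Λ₀ (z, D) * μ j v := by
  intro z D j v hj
  rw [hΛ, hΛ]
  simp only
  by_cases hD : D = D₀
  · subst hD
    have hgj : ∀ u, g j u = μ j u := fun u => by rw [hg' j, if_neg hj]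
    rw [if_pos rfl, one_mul, one_mul, ← hgj (z j), ← hgj v]
    exact tensorFun_update_mul g z j v
  · rw [if_neg hD, zero_mul, zero_mul, zero_mul, zero_mul]

omit [Fintype S] [DecidableEq S] in
/-- The configuration marginal of the augmented warm start is the pinned product law. [ours] -/
theorem pinnedAug_fst (D₀ : Finset (Fin (K + 1))) {g : Fin (K + 1) → S → ℝ}
    {Λ₀ : (Fin (K + 1) → S) × Finset (Fin (K + 1)) → ℝ}
    (hΛ : ∀ a, Λ₀ a = (if a.2 = D₀ then (1 : ℝ) else 0) * tensorFun g a.1) (z : Fin (K + 1) → S) :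
    ∑ D, Λ₀ (z, D) = tensorFun g z := by
  simp_rw [hΛ]
  rw [← Finset.sum_mul, Finset.sum_ite_eq' univ D₀, if_pos (mem_univ _), one_mul]

/-- The tag marginal of the augmented warm start is `δ_{D₀}`. [ours] -/
theorem pinnedAug_snd (hμ1 : ∀ k, ∑ u, μ k u = 1) (D₀ : Finset (Fin (K + 1))) (x : Fin (K + 1) → S)
    {g : Fin (K + 1) → S → ℝ} (hg' : ∀ j u, g j u = if j ∈ D₀ then (if u = x j then (1 : ℝ) else 0) else μ j u)
    {Λ₀ : (Fin (K + 1) → S) × Finset (Fin (K + 1)) → ℝ}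
    (hΛ : ∀ a, Λ₀ a = (if a.2 = D₀ then (1 : ℝ) else 0) * tensorFun g a.1) (D : Finset (Fin (K + 1))) :
    ∑ z : Fin (K + 1) → S, Λ₀ (z, D) = (Pi.single D₀ (1 : ℝ) : Finset (Fin (K + 1)) → ℝ) D := by
  simp_rw [hΛ]
  by_cases hD : D = D₀
  · subst hD
    rw [Pi.single_eq_same, Finset.sum_congr rfl fun z _ => by rw [if_pos rfl, one_mul]]
    exact sum_tensorFun_eq_one g (pinnedLaw_mass_one hμ1 D x hg')
  · rw [Pi.single_eq_of_ne hD, Finset.sum_congr rfl fun z _ => by rw [if_neg hD, zero_mul]]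
    exact Finset.sum_const_zero

/-! ## §2 The warm-start ceiling -/

/-- **THE WARM-START FRESHNESS BOUND: `‖λ₀Pⁿ − π̃‖_TV ≤ Σ_{D≠∅}(δ_{D₀}Qⁿ)(D)`** for the pinned start (replicas in `D₀`
at `x`, the rest exact), both one-sided constants `0 ≤ p, q ≤ 1`. [ours] -/
theorem warmStart_tvDist_le_stale (hm : 1 ≤ m) (ht0 : 0 ≤ t) (ht1 : t ≤ 1) (hw0 : ∀ k, 0 ≤ w k) (hw1 : ∑ k, w k = 1)
    (hμ : ∀ k x, 0 < μ k x) (hμ1 : ∀ k, ∑ u, μ k u = 1) (hM : ∀ k, IsRowStochastic (M k))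
    (hM0 : ∀ u v, M 0 u v = μ 0 v) (hstat : ∀ k : Fin (K + 1), k ≠ 0 → ∀ v, ∑ u, μ k u * M k u v = μ k v)
    (hp0 : 0 ≤ p) (hp1 : p ≤ 1) (hq0 : 0 ≤ q) (hq1 : q ≤ 1) (hdom : ∀ r u, p * μ (κ r).succ (φ r u) ≤ μ 0 u)
    (hrev : ∀ r u, q * μ 0 u ≤ μ (κ r).succ (φ r u))
    {α : Fin m → (Fin (K + 1) → S) → ℝ}
    (hα : ∀ r z, α r z = min 1 (tensorFun μ (edgeFlowSwap (φ r) 0 (κ r).succ z) / tensorFun μ z))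
    {β : Fin m → (Fin (K + 1) → S) → ℝ} (hβ : ∀ r z, β r z = p * μ (κ r).succ (φ r (z 0)) / μ 0 (z 0))
    {β' : Fin m → (Fin (K + 1) → S) → ℝ}
    (hβ' : ∀ r z, β' r z = q * μ 0 ((φ r).symm (z (κ r).succ)) / μ (κ r).succ (z (κ r).succ))
    {γ : Fin m → (Fin (K + 1) → S) × Finset (Fin (K + 1)) → ℝ}
    (hγ : ∀ r a, γ r a = if (0 : Fin (K + 1)) ∉ a.2 then (if (κ r).succ ∉ a.2 then α r a.1 else β r a.1)
      else (if (κ r).succ ∉ a.2 then β' r a.1 else 0))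
    {gbar : Fin m → Finset (Fin (K + 1)) → ℝ}
    (hg : ∀ r D, gbar r D = if (0 : Fin (K + 1)) ∉ D then (if (κ r).succ ∉ D then (1 : ℝ) else p)
      else (if (κ r).succ ∉ D then q else 0))
    {Bset : Fin m → Finset (Fin (K + 1)) → Finset (Fin (K + 1))}
    (hB : ∀ r D, Bset r D = if (0 : Fin (K + 1)) ∉ D ∧ (κ r).succ ∉ D then D
      else insert (0 : Fin (K + 1)) (insert (κ r).succ D))
    {Ph : (Fin (K + 1) → S) × Finset (Fin (K + 1)) → (Fin (K + 1) → S) × Finset (Fin (K + 1)) → ℝ}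
    (hPh : ∀ a b, Ph a b = ∑ r : Fin m, t / m *
        (γ r a * (if b.1 = edgeFlowSwap (φ r) 0 (κ r).succ a.1 ∧ b.2 = a.2.image (Equiv.swap (0 : Fin (K + 1)) (κ r).succ)
            then (1 : ℝ) else 0)
          + (α r a.1 - γ r a) * (if b.1 = edgeFlowSwap (φ r) 0 (κ r).succ a.1 ∧ b.2 = Bset r a.2 then (1 : ℝ) else 0)
          + (1 - α r a.1) * (if b.1 = a.1 ∧ b.2 = Bset r a.2 then (1 : ℝ) else 0))
      + (1 - t) * ∑ k : Fin (K + 1), w k * (coordKernel M k a.1 b.1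
          * (if b.2 = (if k = 0 then a.2.erase 0 else a.2) then (1 : ℝ) else 0)))
    {Q : Finset (Fin (K + 1)) → Finset (Fin (K + 1)) → ℝ}
    (hQ : ∀ D D', Q D D' = ∑ r : Fin m, t / m *
        (gbar r D * (if D' = D.image (Equiv.swap (0 : Fin (K + 1)) (κ r).succ) then (1 : ℝ) else 0)
          + (1 - gbar r D) * (if D' = Bset r D then (1 : ℝ) else 0))
      + (1 - t) * (w 0 * (if D' = D.erase 0 then (1 : ℝ) else 0) + (1 - w 0) * (if D' = D then (1 : ℝ) else 0)))
    (D₀ : Finset (Fin (K + 1))) (x : Fin (K + 1) → S)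
    {g : Fin (K + 1) → S → ℝ} (hg' : ∀ j u, g j u = if j ∈ D₀ then (if u = x j then (1 : ℝ) else 0) else μ j u)
    (n : ℕ) :
    tvDist (lawAt (fun y z : Fin (K + 1) → S =>
          t * ptGraphSwap μ (fun r : Fin m => (((0 : Fin (K + 1)), (κ r).succ) : Fin (K + 1) × Fin (K + 1))) φ y z
          + (1 - t) * prodKernel w M y z) (tensorFun g) n) (tensorFun μ)
      ≤ ∑ D ∈ univ.filter (fun D : Finset (Fin (K + 1)) => D ≠ ∅), lawAt Q (Pi.single D₀ 1) n D := by
  set Λ₀ : (Fin (K + 1) → S) × Finset (Fin (K + 1)) → ℝ := fun a => (if a.2 = D₀ then (1 : ℝ) else 0) * tensorFun g a.1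
    with hΛ_def
  have hΛ : ∀ a, Λ₀ a = (if a.2 = D₀ then (1 : ℝ) else 0) * tensorFun g a.1 := fun _ => rfl
  have hfresh := pinnedAug_fresh (μ := μ) D₀ x hg' hΛ
  have hΛ0 : ∀ a, 0 ≤ Λ₀ a := fun a => by
    rw [hΛ]; exact mul_nonneg (by split_ifs <;> norm_num) (pinnedLaw_nonneg hμ D₀ x hg' a.1)
  have hΛ1 : ∑ a, Λ₀ a = 1 := by
    rw [Fintype.sum_prod_type_right]
    simp_rw [pinnedAug_snd hμ1 D₀ x hg' hΛ]
    rw [Finset.sum_pi_single', if_pos (mem_univ _)]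
  have h := dom_tvDist_le_stale_of κ φ hm ht0 ht1 hw0 hw1 hμ hμ1 hM hM0 hstat hp0 hp1 hq0 hq1 hdom hrev hα hβ hβ' hγ hg
    hB hPh hQ hfresh hΛ0 hΛ1 n
  have hfst : (fun z' => ∑ D, Λ₀ (z', D)) = tensorFun g := funext fun z' => pinnedAug_fst D₀ hΛ z'
  have hsnd : (fun D' => ∑ z : Fin (K + 1) → S, Λ₀ (z, D')) = (Pi.single D₀ (1 : ℝ) : Finset (Fin (K + 1)) → ℝ) :=
    funext fun D' => pinnedAug_snd hμ1 D₀ x hg' hΛ D'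
  rw [hfst, hsnd] at h
  exact h

/-- **THE WARM-START CEILING UNDER ONE-SIDED DOMINATION:** `0 < p ≤ 1`, `p·μ_{l_r}(φ_r u) ≤ μ_0(u)`, `4t ≤ p(1−t)w_0`,
exact hot sampler, stationary cold kernels, hub multiplicities `≥ c ≥ 1`, the pinned start on `D₀`:
**`‖λ₀Pⁿ − π̃‖_TV ≤ ((2·#(D₀∖{0}) + p·𝟙{0 ∈ D₀})/p)·(1 − tcp/(2m))ⁿ`.** [ours] -/
theorem warmStart_tvDist_le (hm : 1 ≤ m) (ht0 : 0 ≤ t) (ht1 : t ≤ 1) (hw0 : ∀ k, 0 ≤ w k) (hw1 : ∑ k, w k = 1)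
    (hμ : ∀ k x, 0 < μ k x) (hμ1 : ∀ k, ∑ u, μ k u = 1) (hM : ∀ k, IsRowStochastic (M k))
    (hM0 : ∀ u v, M 0 u v = μ 0 v) (hstat : ∀ k : Fin (K + 1), k ≠ 0 → ∀ v, ∑ u, μ k u * M k u v = μ k v)
    (hp0 : 0 < p) (hp1 : p ≤ 1) (hdom : ∀ r u, p * μ (κ r).succ (φ r u) ≤ μ 0 u) (hreg : 4 * t ≤ p * (1 - t) * w 0)
    {c : ℕ} (hc1 : 1 ≤ c) (hc : ∀ p' : Fin K, c ≤ (univ.filter (fun r : Fin m => κ r = p')).card) (hcm : c ≤ m)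
    (D₀ : Finset (Fin (K + 1))) (x : Fin (K + 1) → S)
    {g : Fin (K + 1) → S → ℝ} (hg' : ∀ j u, g j u = if j ∈ D₀ then (if u = x j then (1 : ℝ) else 0) else μ j u)
    (n : ℕ) :
    tvDist (lawAt (fun y z : Fin (K + 1) → S =>
          t * ptGraphSwap μ (fun r : Fin m => (((0 : Fin (K + 1)), (κ r).succ) : Fin (K + 1) × Fin (K + 1))) φ y z
          + (1 - t) * prodKernel w M y z) (tensorFun g) n) (tensorFun μ)
      ≤ (2 * ((D₀.erase 0).card : ℝ) + p * (if (0 : Fin (K + 1)) ∈ D₀ then (1 : ℝ) else 0)) / p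
          * (1 - t * c * p / (2 * m)) ^ n := by
  -- the hypothesis-equation objects of the chapter (reverse constant `q = 0`)
  set α : Fin m → (Fin (K + 1) → S) → ℝ :=
    fun r z => min 1 (tensorFun μ (edgeFlowSwap (φ r) 0 (κ r).succ z) / tensorFun μ z) with hα_def
  have hα : ∀ r z, α r z = min 1 (tensorFun μ (edgeFlowSwap (φ r) 0 (κ r).succ z) / tensorFun μ z) := fun _ _ => rfl
  set β : Fin m → (Fin (K + 1) → S) → ℝ := fun r z => p * μ (κ r).succ (φ r (z 0)) / μ 0 (z 0) with hβ_def
  have hβ : ∀ r z, β r z = p * μ (κ r).succ (φ r (z 0)) / μ 0 (z 0) := fun _ _ => rfl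
  set β' : Fin m → (Fin (K + 1) → S) → ℝ :=
    fun r z => (0 : ℝ) * μ 0 ((φ r).symm (z (κ r).succ)) / μ (κ r).succ (z (κ r).succ) with hβ'_def
  have hβ' : ∀ r z, β' r z = (0 : ℝ) * μ 0 ((φ r).symm (z (κ r).succ)) / μ (κ r).succ (z (κ r).succ) :=
    fun _ _ => rfl
  set γ : Fin m → (Fin (K + 1) → S) × Finset (Fin (K + 1)) → ℝ := fun r a =>
    if (0 : Fin (K + 1)) ∉ a.2 then (if (κ r).succ ∉ a.2 then α r a.1 else β r a.1)
      else (if (κ r).succ ∉ a.2 then β' r a.1 else 0) with hγ_def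
  have hγ : ∀ r a, γ r a = if (0 : Fin (K + 1)) ∉ a.2 then (if (κ r).succ ∉ a.2 then α r a.1 else β r a.1)
      else (if (κ r).succ ∉ a.2 then β' r a.1 else 0) := fun _ _ => rfl
  set gbar : Fin m → Finset (Fin (K + 1)) → ℝ := fun r D =>
    if (0 : Fin (K + 1)) ∉ D then (if (κ r).succ ∉ D then (1 : ℝ) else p) else (if (κ r).succ ∉ D then (0 : ℝ) else 0)
    with hg_def
  have hg : ∀ r D, gbar r D = if (0 : Fin (K + 1)) ∉ D then (if (κ r).succ ∉ D then (1 : ℝ) else p)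
      else (if (κ r).succ ∉ D then (0 : ℝ) else 0) := fun _ _ => rfl
  set Bset : Fin m → Finset (Fin (K + 1)) → Finset (Fin (K + 1)) := fun r D =>
    if (0 : Fin (K + 1)) ∉ D ∧ (κ r).succ ∉ D then D else insert (0 : Fin (K + 1)) (insert (κ r).succ D) with hB_def
  have hB : ∀ r D, Bset r D = if (0 : Fin (K + 1)) ∉ D ∧ (κ r).succ ∉ D then D
      else insert (0 : Fin (K + 1)) (insert (κ r).succ D) := fun _ _ => rfl
  set Ph : (Fin (K + 1) → S) × Finset (Fin (K + 1)) → (Fin (K + 1) → S) × Finset (Fin (K + 1)) → ℝ := fun a b =>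
    ∑ r : Fin m, t / m *
        (γ r a * (if b.1 = edgeFlowSwap (φ r) 0 (κ r).succ a.1 ∧ b.2 = a.2.image (Equiv.swap (0 : Fin (K + 1)) (κ r).succ)
            then (1 : ℝ) else 0)
          + (α r a.1 - γ r a) * (if b.1 = edgeFlowSwap (φ r) 0 (κ r).succ a.1 ∧ b.2 = Bset r a.2 then (1 : ℝ) else 0)
          + (1 - α r a.1) * (if b.1 = a.1 ∧ b.2 = Bset r a.2 then (1 : ℝ) else 0))
      + (1 - t) * ∑ k : Fin (K + 1), w k * (coordKernel M k a.1 b.1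
          * (if b.2 = (if k = 0 then a.2.erase 0 else a.2) then (1 : ℝ) else 0)) with hPh_def
  have hPh : ∀ a b, Ph a b = ∑ r : Fin m, t / m *
        (γ r a * (if b.1 = edgeFlowSwap (φ r) 0 (κ r).succ a.1 ∧ b.2 = a.2.image (Equiv.swap (0 : Fin (K + 1)) (κ r).succ)
            then (1 : ℝ) else 0)
          + (α r a.1 - γ r a) * (if b.1 = edgeFlowSwap (φ r) 0 (κ r).succ a.1 ∧ b.2 = Bset r a.2 then (1 : ℝ) else 0)
          + (1 - α r a.1) * (if b.1 = a.1 ∧ b.2 = Bset r a.2 then (1 : ℝ) else 0))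
      + (1 - t) * ∑ k : Fin (K + 1), w k * (coordKernel M k a.1 b.1
          * (if b.2 = (if k = 0 then a.2.erase 0 else a.2) then (1 : ℝ) else 0)) := fun _ _ => rfl
  set Q : Finset (Fin (K + 1)) → Finset (Fin (K + 1)) → ℝ := fun D D' => ∑ r : Fin m, t / m *
        (gbar r D * (if D' = D.image (Equiv.swap (0 : Fin (K + 1)) (κ r).succ) then (1 : ℝ) else 0)
          + (1 - gbar r D) * (if D' = Bset r D then (1 : ℝ) else 0))
      + (1 - t) * (w 0 * (if D' = D.erase 0 then (1 : ℝ) else 0) + (1 - w 0) * (if D' = D then (1 : ℝ) else 0)) with hQ_def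
  have hQ : ∀ D D', Q D D' = ∑ r : Fin m, t / m *
        (gbar r D * (if D' = D.image (Equiv.swap (0 : Fin (K + 1)) (κ r).succ) then (1 : ℝ) else 0)
          + (1 - gbar r D) * (if D' = Bset r D then (1 : ℝ) else 0))
      + (1 - t) * (w 0 * (if D' = D.erase 0 then (1 : ℝ) else 0) + (1 - w 0) * (if D' = D then (1 : ℝ) else 0)) :=
    fun _ _ => rfl
  have hw00 : 0 ≤ w 0 := hw0 0
  have hw01 : w 0 ≤ 1 := by
    have h := Finset.single_le_sum (f := w) (fun k _ => hw0 k) (mem_univ (0 : Fin (K + 1)))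
    rw [hw1] at h; exact h
  have hrev : ∀ r u, (0 : ℝ) * μ 0 u ≤ μ (κ r).succ (φ r u) := fun r u => by rw [zero_mul]; exact (hμ _ _).le
  have hstale := warmStart_tvDist_le_stale κ φ hm ht0 ht1 hw0 hw1 hμ hμ1 hM hM0 hstat hp0.le hp1 le_rfl zero_le_one hdom
    hrev hα hβ hβ' hγ hg hB hPh hQ D₀ x hg' n
  -- the three drift conditions at `b = p/2`, `ρ = tcp/(2m)`, `q = 0`
  have hmpos : (0 : ℝ) < m := Nat.cast_pos.mpr (by omega)
  have hcpos : (0 : ℝ) < c := Nat.cast_pos.mpr (by omega)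
  have hcm' : (c : ℝ) ≤ m := by exact_mod_cast hcm
  have hρt : t * c * p / (2 * m) ≤ t / 2 := by
    have : t * c * p / (2 * m) = t / 2 * (c / m) * p := by field_simp
    rw [this]
    have hcm1 : (c : ℝ) / m ≤ 1 := (div_le_one hmpos).mpr hcm'
    calc t / 2 * (c / m) * p ≤ t / 2 * 1 * 1 := by gcongr
      _ = t / 2 := by ring
  have hρ1 : t * c * p / (2 * m) ≤ 1 := by linarith
  have h1 : t * c * p / (2 * m) ≤ t * c * (p - p / 2) / m := by apply le_of_eq; field_simp; ring
  have h2 : t * c * p / (2 * m) * (p / 2) ≤ (1 - t) * w 0 * (p / 2) - t * (1 - 0 * (p / 2)) := by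
    nlinarith [hρt, hp1, hp0]
  have h3 : t * c * p / (2 * m) ≤ t * (1 - 0 * (p / 2)) * c / m := by
    rw [zero_mul, sub_zero]
    have : t * c * p / (2 * m) = t * (p / 2) * c / m := by field_simp
    rw [this]
    gcongr
    linarith
  have htag := regen_nonempty_le_from κ hm ht0 ht1 hw00 hw01 hp1 le_rfl zero_le_one hg hB hQ hc (by positivity : 0 < p / 2)
    (by linarith : p / 2 ≤ p) hρ1 h1 h2 h3 D₀ n
  have hΦ : ∑ k ∈ D₀, (if k = (0 : Fin (K + 1)) then p / 2 else (1 : ℝ))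
      = ((D₀.erase 0).card : ℝ) + p / 2 * (if (0 : Fin (K + 1)) ∈ D₀ then (1 : ℝ) else 0) := by
    by_cases h0 : (0 : Fin (K + 1)) ∈ D₀
    · rw [← Finset.insert_erase h0, Finset.sum_insert (Finset.notMem_erase 0 D₀), if_pos rfl, Finset.erase_insert
        (Finset.notMem_erase 0 D₀), if_pos (Finset.mem_insert_self _ _)]
      rw [Finset.sum_congr rfl fun k hk => if_neg (Finset.ne_of_mem_erase hk), sum_const, nsmul_eq_mul, mul_one]
      ring
    · rw [if_neg h0, mul_zero, add_zero, Finset.erase_eq_of_notMem h0,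
        Finset.sum_congr rfl fun k hk => if_neg (fun h => h0 (by rw [h] at hk; exact hk)), sum_const, nsmul_eq_mul,
        mul_one]
  rw [hΦ] at htag
  refine hstale.trans (htag.trans (le_of_eq ?_))
  field_simp

/-- **THE WARM-START TIME: `‖λ₀Pⁿ − π̃‖_TV ≤ ε` ONCE `n ≥ (2m/(tcp))·log((2·#(D₀∖{0}) + p·𝟙{0∈D₀})/(pε))`** (`0 < t`,
`D₀` non-empty). [ours] -/
theorem warmStart_tvDist_le_of_ge_log (hm : 1 ≤ m) (ht0 : 0 < t) (ht1 : t ≤ 1) (hw0 : ∀ k, 0 ≤ w k)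
    (hw1 : ∑ k, w k = 1) (hμ : ∀ k x, 0 < μ k x) (hμ1 : ∀ k, ∑ u, μ k u = 1) (hM : ∀ k, IsRowStochastic (M k))
    (hM0 : ∀ u v, M 0 u v = μ 0 v) (hstat : ∀ k : Fin (K + 1), k ≠ 0 → ∀ v, ∑ u, μ k u * M k u v = μ k v)
    (hp0 : 0 < p) (hp1 : p ≤ 1) (hdom : ∀ r u, p * μ (κ r).succ (φ r u) ≤ μ 0 u) (hreg : 4 * t ≤ p * (1 - t) * w 0)
    {c : ℕ} (hc1 : 1 ≤ c) (hc : ∀ p' : Fin K, c ≤ (univ.filter (fun r : Fin m => κ r = p')).card) (hcm : c ≤ m)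
    (D₀ : Finset (Fin (K + 1))) (hD₀ : D₀.Nonempty) (x : Fin (K + 1) → S)
    {g : Fin (K + 1) → S → ℝ} (hg' : ∀ j u, g j u = if j ∈ D₀ then (if u = x j then (1 : ℝ) else 0) else μ j u)
    {ε : ℝ} (hε : 0 < ε) {n : ℕ}
    (hn : 2 * (m : ℝ) / (t * c * p)
      * Real.log ((2 * ((D₀.erase 0).card : ℝ) + p * (if (0 : Fin (K + 1)) ∈ D₀ then (1 : ℝ) else 0)) / (p * ε)) ≤ n) :
    tvDist (lawAt (fun y z : Fin (K + 1) → S =>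
          t * ptGraphSwap μ (fun r : Fin m => (((0 : Fin (K + 1)), (κ r).succ) : Fin (K + 1) × Fin (K + 1))) φ y z
          + (1 - t) * prodKernel w M y z) (tensorFun g) n) (tensorFun μ) ≤ ε := by
  have hmpos : (0 : ℝ) < m := Nat.cast_pos.mpr (by omega)
  have hcpos : (0 : ℝ) < c := Nat.cast_pos.mpr (by omega)
  have hcm' : (c : ℝ) ≤ m := by exact_mod_cast hcm
  refine (warmStart_tvDist_le κ φ hm ht0.le ht1 hw0 hw1 hμ hμ1 hM hM0 hstat hp0 hp1 hdom hreg hc1 hc hcm D₀ x hg' n).trans ?_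
  have ha0 : 0 < t * c * p / (2 * m) := by positivity
  have ha1 : t * c * p / (2 * m) ≤ 1 := by
    rw [div_le_one (by positivity)]
    have h1 : t * c ≤ 1 * m := by nlinarith
    nlinarith
  -- the constant is positive because `D₀` is non-empty
  have hC : 0 < (2 * ((D₀.erase 0).card : ℝ) + p * (if (0 : Fin (K + 1)) ∈ D₀ then (1 : ℝ) else 0)) / p := by
    refine div_pos ?_ hp0
    by_cases h0 : (0 : Fin (K + 1)) ∈ D₀
    · rw [if_pos h0, mul_one]; positivity
    · rw [if_neg h0, mul_zero, add_zero]
      obtain ⟨k, hk⟩ := hD₀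
      have hk' : k ∈ D₀.erase 0 := Finset.mem_erase.mpr ⟨fun h => h0 (h ▸ hk), hk⟩
      have : 0 < ((D₀.erase 0).card : ℝ) := by exact_mod_cast Finset.card_pos.mpr ⟨k, hk'⟩
      linarith
  refine geom_le_of_ge_log ha0 ha1 hC hε ?_
  have e1 : 1 / (t * c * p / (2 * m)) = 2 * (m : ℝ) / (t * c * p) := by field_simp
  have e2 : (2 * ((D₀.erase 0).card : ℝ) + p * (if (0 : Fin (K + 1)) ∈ D₀ then (1 : ℝ) else 0)) / p / ε
      = (2 * ((D₀.erase 0).card : ℝ) + p * (if (0 : Fin (K + 1)) ∈ D₀ then (1 : ℝ) else 0)) / (p * ε) := by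
    rw [div_div]
  rw [e1, e2]; exact hn

end WarmStart

end Summit.Ventures.LatticeQCDFlow.Scaling

end
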